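import Literature.Computability.Cryptography.YaoAmplification
import Literature.Computability.Cryptography.HybridSampling
import Literature.Computability.Complexity.PlumbingBricks
import Literature.Computability.Complexity.FoldBricks
import Literature.Computability.Complexity.CountingHierarchyProofs
import Literature.Computability.Complexity.TimeBoundsProofs
import Literature.Computability.Complexity.PairingMachines
import HarnessLib

/-!
# One-way functions may be assumed length-preserving (Goldreich 2001, §2.2.3.2, Prop. 2.2.5)

**Source.** O. Goldreich, *Foundations of Cryptography I: Basic Tools*, CUP 2001, §2.2.3 ("Length conventions").
§2.2.3.2, Def. 2.2.4 (length-preserving: `|f(x)| = |x|`) and the paragraph after it: "Given a strongly (resp.,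
weakly) one-way function `f`, we can construct a strongly (resp., weakly) one-way function `f''` that is
length-preserving, as follows. Let `p` be a polynomial bounding the length expansion of `f` (i.e.,
`|f(x)| ≤ p(|x|)`). … `f'(x) = f(x)10^{p(|x|)-|f(x)|}` (2.3) … `f''(x'x'') = f'(x')`, where `|x'x''| = p(|x'|) + 1`
(2.4). Clearly, `f''` is length-preserving. **Proposition 2.2.5:** If `f` is a strongly (resp., weakly) one-way
function, then so are `f'` and `f''`." The function `f''` is defined only on the lengths `p(n) + 1`; §2.2.3.1,
Prop. 2.2.3 with eq. (2.2), `g'(x) = f(x')x''` ("`x'` is the longest prefix of `x` with length in `I`"),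
extends a length-preserving function that is one-way on the lengths of a polynomial-time-enumerable set `I` to a
length-preserving one-way function on all lengths. The printed proof of Prop. 2.2.5 is a sketch ("Using
'reducibility arguments' analogous to the one used in the preceding proof … On input `y` and `1ⁿ` … algorithm `A'`
halts with output `B'(y10^{p(n)-|y|}, 1ⁿ)`"); this file supplies the reduction in the tree's model.

**The construction** (`LenPres.g p f`, both steps at once, for the length bound `p(n) + n` — which leaves room
for the `n` argument bits inside a block of length `M n = p(n) + n + 1`): on `w` with `|w| = m ≥ M 0` let
`n = nOf m` be the largest `n` with `M n ≤ m` and put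
`g(w) = f(w ↾ n) 1 0^{M n - 1 - |f(w ↾ n)|} (w ⇂ M n)`; strings shorter than `M 0` are mapped identically.
`g` is length-preserving (`LenPres.isLengthPreserving_g`) and polynomial-time (`LenPres.g_mem_FP`: the block
length by a clocked search, then `take`/`pad10`/`drop`/concatenation bricks — no machine is programmed).

**The reduction** (`LenPres.isOneWay_g`). Let `A` be a PPT inverter for `g` with success `≥ 1/m^k` on `U_m` for
infinitely many `m`; each such `m = M n + j`, `j < M(n+1) - M n`, makes the *level* `n = nOf m` good, and
`nOf m → ∞`, so infinitely many levels are good. The inverter `A'` for `f` (`LenPres.adv`) on `⟨1ⁿ, y⟩` pads `y`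
to `pad (M n - 1) y`, appends `j` fresh coins `z`, runs `A` on `⟨1^{M n + j}, pad (M n - 1) y ++ z⟩` and
outputs the first `n` bits of the answer: a `g`-preimage `w'` of `pad (M n - 1) (f x) ++ z` has length
`M n + j` (length preservation), hence level `n`, hence `pad (M n - 1) (f (w' ↾ n)) = pad (M n - 1) (f x)` and
`f (w' ↾ n) = f x` (the `10*` padding is injective; `LenPres.f_take_eq_of_g_eq`). Counting over
`{0,1}^{M n + j} × coins ≃ {0,1}ⁿ × {0,1}^{M n - n} × {0,1}^j × coins` gives
`Pr[A inverts g on U_{M n + j}] ≤ Pr[A' inverts f on U_n]` (`LenPres.invertProb_g_le`), so `A'` succeeds with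
probability `≥ 1/M(n+1)^k` at infinitely many `n`, contradicting `M(n+1)^k · Pr[A' inverts f on U_n] → 0`.

**Two features of the tree's model of probabilistic machines** (`RandAlg`: the coin budget `coinLen` is an
arbitrary polynomially bounded function of the *input length*), handled exactly as in `YaoAmplification.lean`:
(i) neither the offset `j = j(n)` of a good length of level `n` nor `A`'s coin count `κ` on the corresponding
queries is computable from `n`, so both are carried by the number of coins of `A'`,
`|r| = j · K n + κ` with `K n = q_A(3M(n+1)+2) + 1 > κ` (`LenPres.Setting.Code`; `A'` decodes by `div`/`mod`,
`LenPres.advCore`); (ii) the input length `|⟨1ⁿ, f x⟩| = 2n + 2 + |f x|` of `A'` does not determine `n` (`f`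
being arbitrary), so the budget is installed only along a sparse infinite sequence of good levels with disjoint
input-length ranges `[2n+2, 2n+2+p(n)]` (`Yao.seqN`, `Yao.sel`, `LenPres.Setting.cl_eq`) — enough for
"infinitely often". The budget is polynomially bounded (`LenPres.Setting.cl_le`), which is all `IsPPT` asks.

## Main statements

* `LenPres.g`, `LenPres.isLengthPreserving_g`, `LenPres.g_mem_FP`, `LenPres.isOneWay_g`;
* `IsOneWay.exists_isLengthPreserving : IsOneWay f → ∃ g, IsOneWay g ∧ IsLengthPreserving g`;
* `OWFExist.exists_isLengthPreserving : OWFExist → ∃ g, IsOneWay g ∧ IsLengthPreserving g`.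

Not here: the "weakly one-way" half of Prop. 2.2.5 (its reduction must attack *all* lengths of a level, by the
try-all-candidates inverter of Prop. 2.2.3, a clocked loop as in `YaoInvProgram.lean`; with Thm. 2.3.2 —
`weakOWFExist_iff_OWFExist_holds` — the strong half suffices for existence statements), and the remarks on 1-1
functions (eq. (2.4) does not preserve injectivity).

## References

* O. Goldreich, *Foundations of Cryptography I: Basic Tools*, Cambridge University Press 2001 (2004 printing,
  doi:10.1017/CBO9780511721656), §2.2.3.1 (Prop. 2.2.3, eqs. (2.1)–(2.2)), §2.2.3.2 (Def. 2.2.4, eqs. (2.3)–(2.4),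
  Prop. 2.2.5), Def. 2.2.1, §1.3.2.
* S. Arora, B. Barak, *Computational Complexity: A Modern Approach*, CUP 2009, §1.3 (composition of
  polynomial-time computations), §1.4.1 (clocked loops), §7.1 (probabilistic machines with a random tape).
-/

namespace Literature.Computability.Cryptography

open Filter Asymptotics _root_.Computability Complexity Finset Polynomial

namespace LenPres

/-! ### Padding `y ↦ y 1 0^{L - |y|}` -/

/-- The `10*`-padding of a string to length `L + 1`: `pad L y = y 1 0^{L-|y|}` (for `|y| ≤ L`).
[Goldreich 2001, §2.2.3.2, eq. (2.3)] [cite: Goldreich2001, §2.2.3.2 eq. (2.3)] -/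
def pad (L : ℕ) (y : List Bool) : List Bool := y ++ true :: List.replicate (L - y.length) false

/-- Removing the padding: drop the trailing `0`s and the final `1` ("we use a padding of the form `10*`
in order to facilitate the parsing of `f'(x)` into `f(x)` and the leftover padding").
[Goldreich 2001, §2.2.3.2] [folklore] -/
def unpad (s : List Bool) : List Bool := ((s.reverse.dropWhile fun b => b == false).drop 1).reverse

/-- `unpad` is a left inverse of `pad L`. [folklore] -/
theorem unpad_pad (L : ℕ) (y : List Bool) : unpad (pad L y) = y := by
  simp only [unpad, pad, List.reverse_append, List.reverse_cons, List.reverse_replicate,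
    List.append_assoc, List.singleton_append]
  rw [List.dropWhile_append_of_pos ?_]
  · simp
  · intro b hb
    rw [List.mem_replicate] at hb
    simp [hb.2]

/-- `pad L` is injective (for every `L`, on all strings). [folklore] -/
theorem pad_injective (L : ℕ) : Function.Injective (pad L) := fun y y' h => by
  have := congrArg unpad h
  rwa [unpad_pad, unpad_pad] at this

/-- `|pad L y| = L + 1` for `|y| ≤ L`. [Goldreich 2001, §2.2.3.2, eq. (2.3)] [folklore] -/
theorem length_pad {L : ℕ} {y : List Bool} (hy : y.length ≤ L) : (pad L y).length = L + 1 := by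
  simp [pad]; omega

/-! ### The designed lengths `M n = p(n) + n + 1` and the block length `nOf m` -/

variable (p : Polynomial ℕ)

/-- The input length of level `n`: `M n = p(n) + n + 1` — Goldreich's `p(n) + 1` (eq. (2.4)) for the
length bound `p(n) + n`, which leaves room for the `n` argument bits. [Goldreich 2001, §2.2.3.2, eq. (2.4)]
[cite: Goldreich2001, §2.2.3.2 eq. (2.4)] -/
def M (n : ℕ) : ℕ := p.eval n + n + 1

/-- The block length used on inputs of length `m`: the largest `n ≤ m` with `M n ≤ m` (the length in
`I = {M n}` of "the longest prefix of `x` with length in `I`", eq. (2.2)). [Goldreich 2001, §2.2.3.1, eq. (2.2)]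
[cite: Goldreich2001, Prop. 2.2.3 (eq. (2.2))] -/
def nOf (m : ℕ) : ℕ := Nat.findGreatest (fun n => M p n ≤ m) m

variable {p}

/-- `M` is strictly increasing. [folklore] -/
theorem M_strictMono : StrictMono (M p) := by
  refine strictMono_nat_of_lt_succ fun n => ?_
  unfold M
  have := TM2Iter.eval_mono p (show n ≤ n + 1 by omega)
  omega

/-- `n < M n`. [folklore] -/
theorem lt_M (n : ℕ) : n < M p n := by unfold M; omega

/-- `M (nOf m) ≤ m` once `M 0 ≤ m`. [folklore] -/
theorem M_nOf_le {m : ℕ} (hm : M p 0 ≤ m) : M p (nOf p m) ≤ m :=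
  Nat.findGreatest_spec (P := fun n => M p n ≤ m) (Nat.zero_le m) hm

/-- `m < M (nOf m + 1)`. [folklore] -/
theorem lt_M_nOf_succ (m : ℕ) : m < M p (nOf p m + 1) := by
  by_contra h
  push Not at h
  have hle : nOf p m + 1 ≤ m := (lt_M _).le.trans h
  have := Nat.le_findGreatest (P := fun n => M p n ≤ m) hle h
  unfold nOf at this
  omega

/-- `M n ≤ m < M (n+1)` gives `nOf m = n`. [folklore] -/
theorem nOf_eq {n m : ℕ} (h1 : M p n ≤ m) (h2 : m < M p (n + 1)) : nOf p m = n := by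
  have hmono := M_strictMono (p := p)
  have ha : M p (nOf p m) ≤ m := M_nOf_le ((hmono.monotone (Nat.zero_le n)).trans h1)
  have hb : m < M p (nOf p m + 1) := lt_M_nOf_succ m
  have h3 : nOf p m < n + 1 := hmono.lt_iff_lt.1 (ha.trans_lt h2)
  have h4 : n < nOf p m + 1 := hmono.lt_iff_lt.1 (h1.trans_lt hb)
  omega

/-- `nOf m → ∞`. [folklore] -/
theorem tendsto_nOf : Tendsto (nOf p) atTop atTop := by
  refine tendsto_atTop_atTop.2 fun n => ⟨M p n, fun m hm => ?_⟩
  by_contra h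
  push Not at h
  have hb := lt_M_nOf_succ (p := p) m
  have : M p (nOf p m + 1) ≤ M p n := M_strictMono.monotone (by omega)
  omega

/-! ### The length-preserving function -/

/-- **The length-preserving version of `f`** (Goldreich's `g'` of eq. (2.2) applied to the `f''` of
eq. (2.4)): on `w` of length `m ≥ M 0`, with `n = nOf m`, apply `f` to the first `n` bits, pad the image
with `10*` to length `M n`, and copy the suffix `w ⇂ M n` verbatim; strings shorter than `M 0` are
mapped identically. [Goldreich 2001, §2.2.3, eqs. (2.2)–(2.4)] [cite: Goldreich2001, Prop. 2.2.5 with Prop. 2.2.3] -/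
def g (p : Polynomial ℕ) (f : List Bool → List Bool) (w : List Bool) : List Bool :=
  if M p 0 ≤ w.length then
    pad (M p (nOf p w.length) - 1) (f (w.take (nOf p w.length))) ++ w.drop (M p (nOf p w.length))
  else w

/-- The output-length bound `|f x| ≤ p(|x|)`. [Goldreich 2001, §2.2.3.2 ("Let `p` be a polynomial
bounding the length expansion of `f`")] [folklore] -/
def LenBound (p : Polynomial ℕ) (f : List Bool → List Bool) : Prop := ∀ x, (f x).length ≤ p.eval x.length

variable {f : List Bool → List Bool}

/-- On level `n`: `g w = pad (M n - 1) (f (w ↾ n)) ++ w ⇂ M n` for `M n ≤ |w| < M (n+1)`. [folklore] -/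
theorem g_eq_of_level {n : ℕ} {w : List Bool} (h1 : M p n ≤ w.length) (h2 : w.length < M p (n + 1)) :
    g p f w = pad (M p n - 1) (f (w.take n)) ++ w.drop (M p n) := by
  have hn : nOf p w.length = n := nOf_eq h1 h2
  have h0 : M p 0 ≤ w.length := (M_strictMono.monotone (Nat.zero_le n)).trans h1
  simp only [g, if_pos h0, hn]

/-- The padded image of level `n` has length `M n`. [folklore] -/
theorem length_pad_level (hp : LenBound p f) {n : ℕ} {x : List Bool} (hx : x.length = n) :
    (pad (M p n - 1) (f x)).length = M p n := by
  have h := hp x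
  rw [hx] at h
  rw [length_pad (by unfold M; omega)]
  unfold M; omega

/-- **`g` is length-preserving.** [Goldreich 2001, §2.2.3.2 ("Clearly, `f''` is length-preserving"),
§2.2.3.1 (eq. (2.2) preserves it)] [cite: Goldreich2001, Prop. 2.2.5 with Prop. 2.2.3] -/
theorem isLengthPreserving_g (hp : LenBound p f) : IsLengthPreserving (g p f) := by
  intro w
  unfold g
  split_ifs with h0
  · have h1 := M_nOf_le (p := p) h0
    have hlt := lt_M (p := p) (nOf p w.length)
    rw [List.length_append, length_pad_level hp (by rw [List.length_take]; omega), List.length_drop]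
    omega
  · rfl

/-- **A `g`-preimage yields an `f`-preimage.** If `g w' = pad (M n - 1) (f x) ++ z` with `|x| = n`,
`|z| = j`, `M n + j < M (n+1)`, then `f (w' ↾ n) = f x`. [Goldreich 2001, Prop. 2.2.5 (proof sketch:
the reduction strips the padding)] [folklore] -/
theorem f_take_eq_of_g_eq (hp : LenBound p f) {n j : ℕ} (hj : M p n + j < M p (n + 1)) {x z w' : List Bool}
    (hx : x.length = n) (hz : z.length = j) (h : g p f w' = pad (M p n - 1) (f x) ++ z) : f (w'.take n) = f x := by
  have hlen : w'.length = M p n + j := by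
    rw [← isLengthPreserving_g hp w', h, List.length_append, length_pad_level hp hx, hz]
  have hlt := lt_M (p := p) n
  rw [g_eq_of_level (n := n) (by omega) (by omega)] at h
  have h' := List.append_inj_left h (by
    rw [length_pad_level hp hx, length_pad_level hp (by rw [List.length_take]; omega)])
  exact pad_injective _ h'

/-! ### `g` is polynomial-time computable -/

section Program

open Complexity.Brick Complexity.Plumb Complexity.OracleCompose

variable (p)

/-- `M1poly(k) = M (k+1)`. [folklore] -/
noncomputable def M1poly : Polynomial ℕ := (p + X + 1).comp (X + 1)

/-- `M1poly(k) = M (k+1)`. [folklore] -/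
@[simp] theorem eval_M1poly (k : ℕ) : (M1poly p).eval k = M p (k + 1) := by
  simp [M1poly, M]

/-- The search step: `k ↦ k + 1` while `M (k+1) ≤ m` (the clocked search of `YaoFunProgram.lean`,
`GProg.nstep`, for the present `M`). [folklore] -/
def nstep (m k : ℕ) : ℕ := if M p (k + 1) ≤ m then k + 1 else k

/-- The stop condition `[|w| + 1 ≤ M (k+1)]` on the search state `⟨w, 1ᵏ⟩`. [folklore] -/
noncomputable def nOfCond : List Bool → List Bool := lenLeFn (M1poly p) ∘ fanoutFn sndF (List.cons true ∘ fstF)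

/-- One round of the search on `⟨w, 1ᵏ⟩`. [folklore] -/
noncomputable def nOfRound : List Bool → List Bool :=
  fanoutFn fstF (iteFn (nOfCond p) sndF (List.cons true ∘ sndF))

/-- Value of the stop condition. [folklore] -/
theorem nOfCond_state (w : List Bool) (k : ℕ) :
    nOfCond p (boolPair w (ones k)) = [decide (w.length + 1 ≤ M p (k + 1))] := by
  simp [nOfCond, lenLeFn_boolPair]

/-- Value of one round. [folklore] -/
theorem nOfRound_state (w : List Bool) (k : ℕ) :
    nOfRound p (boolPair w (ones k)) = boolPair w (ones (nstep p w.length k)) := by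
  unfold nOfRound nstep
  rw [fanoutFn_apply, fstF_boolPair]
  by_cases h : M p (k + 1) ≤ w.length
  · rw [iteFn_apply_false (by rw [nOfCond_state, decide_eq_false (by omega)]), if_pos h]
    simp [List.replicate_succ]
  · rw [iteFn_apply_true (by rw [nOfCond_state, decide_eq_true (by omega)]), if_neg h]
    simp

/-- Additive growth of one round. [folklore] -/
theorem length_nOfRound_le (w : List Bool) : (nOfRound p w).length ≤ w.length + 3 := by
  have h1 := length_boolUnpair_parts_le w
  unfold nOfRound
  rcases lenLeFn_eq_or (M1poly p) (fanoutFn sndF (List.cons true ∘ fstF) w) with h | h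
  · rw [fanoutFn_apply, iteFn_apply_true (by simpa [nOfCond] using h)]
    simp only [length_boolPair, fstF, sndF]; omega
  · rw [fanoutFn_apply, iteFn_apply_false (by simpa [nOfCond] using h)]
    simp only [length_boolPair, fstF, sndF, Function.comp_apply, List.length_cons]; omega

/-- **The search computes `nOf`**: after `j ≤ m` rounds the counter is `min j (nOf m)`. [folklore] -/
theorem iterate_nstep (m : ℕ) : ∀ j, j ≤ m → (nstep p m)^[j] 0 = min j (nOf p m)
  | 0, _ => by simp
  | j + 1, hj => by
    rw [Function.iterate_succ_apply', iterate_nstep m j (by omega)]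
    have hGm : nOf p m ≤ m := Nat.findGreatest_le m
    have hG2 : ∀ n, nOf p m < n → n ≤ m → ¬ M p n ≤ m := fun n h1 h2 =>
      Nat.findGreatest_is_greatest (P := fun k => M p k ≤ m) h1 h2
    unfold nstep
    by_cases hjG : j < nOf p m
    · have hG1 : M p (nOf p m) ≤ m := by
        by_cases h0 : M p 0 ≤ m
        · exact M_nOf_le h0
        · exfalso
          have : nOf p m = 0 := by
            unfold nOf
            rw [Nat.findGreatest_eq_zero_iff]
            intro k _ _ hk
            exact h0 ((M_strictMono.monotone (Nat.zero_le k)).trans hk)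
          omega
      rw [min_eq_left hjG.le, if_pos ((M_strictMono.monotone (by omega)).trans hG1), min_eq_left (by omega)]
    · rw [min_eq_right (by omega), if_neg (hG2 _ (Nat.lt_succ_self _) (by omega)), min_eq_right (by omega)]

/-- Rounds of the search on a state. [folklore] -/
theorem iterate_nOfRound (w : List Bool) :
    ∀ j, (nOfRound p)^[j] (boolPair w (ones 0)) = boolPair w (ones ((nstep p w.length)^[j] 0))
  | 0 => rfl
  | j + 1 => by rw [Function.iterate_succ_apply', iterate_nOfRound w j, nOfRound_state, Function.iterate_succ_apply']

/-- **`nOfFn w = 1^{nOf |w|}`**: the block length in unary, by `|w|` rounds of the search. [folklore] -/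
noncomputable def nOfFn : List Bool → List Bool :=
  sndF ∘ (fun z => (nOfRound p)^[X.eval (boolUnpair z).1.length] z) ∘ fanoutFn id (fun _ => [])

/-- Value of `nOfFn`. [folklore] -/
@[simp] theorem nOfFn_apply (w : List Bool) : nOfFn p w = ones (nOf p w.length) := by
  have h := iterate_nOfRound p w w.length
  rw [iterate_nstep p w.length w.length le_rfl, min_eq_right (show nOf p w.length ≤ w.length from Nat.findGreatest_le _)] at h
  simp only [nOfFn, Function.comp_apply, fanoutFn_apply, id, boolUnpair_boolPair, eval_X]
  rw [show (boolPair w [] : List Bool) = boolPair w (ones 0) from rfl, h, sndF_boolPair]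

/-- `nOfFn ∈ FP`. [Arora–Barak 2009, §1.4.1 (clocked loops)] [folklore] -/
theorem nOfFn_mem_FP : nOfFn p ∈ FP :=
  comp_mem_FP sndF_mem_FP (comp_mem_FP
    (iterate_mem_FP (fanoutFn_mem_FP fstF_mem_FP (iteFn_mem_FP
      (comp_mem_FP (lenLeFn_mem_FP _) (fanoutFn_mem_FP sndF_mem_FP (comp_mem_FP (cons_mem_FP true) fstF_mem_FP)))
      sndF_mem_FP (comp_mem_FP (cons_mem_FP true) sndF_mem_FP))) 3 (length_nOfRound_le p) X)
    (fanoutFn_mem_FP OracleCompose.id_mem_FP (const_mem_FP [])))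

variable (f)

/-- `1^{M n - 1} = 1^{p(n) + n}`, `n = nOf |w|`. [folklore] -/
noncomputable def LF : List Bool → List Bool := polyFn (p + X) ∘ nOfFn p

/-- The padded image `pad (M n - 1) (f (w ↾ n))`. [folklore] -/
noncomputable def padF : List Bool → List Bool :=
  pad10Fn ∘ fanoutFn (LF p) (f ∘ takeFn ∘ fanoutFn (nOfFn p) id)

/-- The level-`n` branch `pad (M n - 1) (f (w ↾ n)) ++ w ⇂ M n`. [folklore] -/
noncomputable def mainF : List Bool → List Bool :=
  concatFn ∘ fanoutFn (padF p f) (dropFn ∘ fanoutFn (List.cons true ∘ LF p) id)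

/-- **`g` as a brick pipeline**: identity below length `M 0`, the level branch otherwise. [folklore] -/
noncomputable def gF : List Bool → List Bool :=
  iteFn (ltLenF ∘ fanoutFn id (fun _ => ones (M p 0))) id (mainF p f)

variable {f p}

/-- Value of `LF`. [folklore] -/
theorem LF_apply (w : List Bool) : LF p w = ones (M p (nOf p w.length) - 1) := by
  simp only [LF, Function.comp_apply, nOfFn_apply, polyFn_apply, List.length_replicate, eval_add, eval_X, M]
  congr 1

/-- Value of `mainF`. [folklore] -/
theorem mainF_apply (w : List Bool) :
    mainF p f w = pad (M p (nOf p w.length) - 1) (f (w.take (nOf p w.length))) ++ w.drop (M p (nOf p w.length)) := by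
  have hL := LF_apply (p := p) w
  have hM : M p (nOf p w.length) - 1 + 1 = M p (nOf p w.length) := by unfold M; omega
  simp only [mainF, padF, Function.comp_apply, fanoutFn_apply, hL, nOfFn_apply, id, takeFn_boolPair, List.length_replicate,
    pad10Fn_boolPair, concatFn_boolPair, dropFn_boolPair, List.length_cons, hM]
  rfl

/-- **The pipeline computes `g`.** [folklore] -/
theorem gF_eq : gF p f = g p f := by
  funext w
  have hc : (ltLenF ∘ fanoutFn id (fun _ => ones (M p 0))) w = [decide (w.length < M p 0)] := by
    simp
  unfold gF g
  by_cases h0 : M p 0 ≤ w.length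
  · rw [iteFn_apply_false (by rw [hc, decide_eq_false (by omega)]), if_pos h0, mainF_apply]
  · rw [iteFn_apply_true (by rw [hc, decide_eq_true (by omega)]), if_neg h0, id]

/-- **`g` is polynomial-time computable** for polynomial-time `f` ("It is quite easy to see that both
`f'` and `f''` are polynomial-time-computable"). [Goldreich 2001, Prop. 2.2.5 (proof sketch)]
[cite: Goldreich2001, Prop. 2.2.5 (proof sketch)] -/
theorem g_mem_FP (hf : f ∈ FP) : g p f ∈ FP := by
  rw [← gF_eq]
  have hL : LF p ∈ FP := comp_mem_FP (polyFn_mem_FP _) (nOfFn_mem_FP p)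
  have hpad : padF p f ∈ FP := comp_mem_FP pad10Fn_mem_FP (fanoutFn_mem_FP hL
    (comp_mem_FP hf (comp_mem_FP takeFn_mem_FP (fanoutFn_mem_FP (nOfFn_mem_FP p) id_mem_FP))))
  have hmain : mainF p f ∈ FP := comp_mem_FP concatFn_mem_FP (fanoutFn_mem_FP hpad
    (comp_mem_FP dropFn_mem_FP (fanoutFn_mem_FP (comp_mem_FP (cons_mem_FP true) hL) id_mem_FP)))
  exact iteFn_mem_FP (comp_mem_FP ltLenF_mem_FP (fanoutFn_mem_FP id_mem_FP (const_mem_FP _))) id_mem_FP hmain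

end Program

/-! ### The inverter for `f` built from an inverter for `g` -/

section Adversary

open Complexity.Brick Complexity.Plumb Complexity.OracleCompose

/-- `|1ⁿ| = n`. [folklore] -/
private theorem length_unaryEncodeNat (n : ℕ) : (unaryEncodeNat n).length = n := unary_decode_encode_nat n

variable (p) (A : RandAlg (List Bool) (List Bool)) (qA : Polynomial ℕ)

/-- A bound `K n = q_A(3 M(n+1) + 2) + 1` exceeding the coin count of `A` on every query of level `n`
(`q_A` a polynomial bound on `A`'s coin budget). [folklore] -/
noncomputable def Kpoly : Polynomial ℕ := qA.comp (C 3 * M1poly p + C 2) + 1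

/-- `K n`. [folklore] -/
noncomputable def K (n : ℕ) : ℕ := (Kpoly p qA).eval n

/-- Value of `K`. [folklore] -/
theorem K_eq (n : ℕ) : K p qA n = qA.eval (3 * M p (n + 1) + 2) + 1 := by
  simp [K, Kpoly]

/-- **The query** of level `n` for the target `y` and the suffix `z`: `⟨1^{M n + |z|}, pad (M n - 1) y ++ z⟩`
("algorithm `A'` halts with output `B'(y10^{p(n)-|y|}, …)`", combined with the suffix of eq. (2.2)).
[Goldreich 2001, Prop. 2.2.5 (proof sketch) with Prop. 2.2.3] [cite: Goldreich2001, Prop. 2.2.5 (proof sketch)] -/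
def query (n : ℕ) (y z : List Bool) : List Bool :=
  boolPair (unaryEncodeNat (M p n + z.length)) (pad (M p n - 1) y ++ z)

/-- **The run of the inverter** on `(n, y)` with coins `r`: decode `(j, κ) = (|r| / K n, |r| mod K n)`,
query `A` on `⟨1^{M n + j}, pad (M n - 1) y ++ r ↾ j⟩` with the next `κ` coins, output the first `n`
bits of the answer. [Goldreich 2001, Prop. 2.2.5 (proof sketch); the coin-count device of
`YaoAmplification.lean`] [cite: Goldreich2001, Prop. 2.2.5 (proof sketch)] -/
noncomputable def advCore (n : ℕ) (y r : List Bool) : List Bool :=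
  (A.run (query p n y (r.take (r.length / K p qA n)))
    ((r.drop (r.length / K p qA n)).take (r.length % K p qA n))).take n

/-- The run function on the input `⟨1ⁿ, y⟩`. [folklore] -/
noncomputable def advRun (inp r : List Bool) : List Bool := advCore p A qA (boolUnpair inp).1.length (boolUnpair inp).2 r

/-- **The inverter `A'` for `f`** with a prescribed coin budget `cl`. [Goldreich 2001, Prop. 2.2.5 (proof sketch)]
[cite: Goldreich2001, Prop. 2.2.5 (proof sketch)] -/
noncomputable def adv (cl : ℕ → ℕ) : RandAlg (List Bool) (List Bool) where
  run := advRun p A qA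
  coinLen := cl

variable {p A qA}

/-- The run on a well-formed input. [folklore] -/
theorem advRun_boolPair (n : ℕ) (y r : List Bool) :
    advRun p A qA (boolPair (unaryEncodeNat n) y) r = advCore p A qA n y r := by
  simp [advRun]

/-- Length of a query of level `n` with `|z| = j`: `3(M n + j) + 2`. [folklore] -/
theorem length_query (hp : LenBound p f) {n : ℕ} {x z : List Bool} (hx : x.length = n) :
    (query p n (f x) z).length = 3 * (M p n + z.length) + 2 := by
  simp only [query, length_boolPair, length_unaryEncodeNat, List.length_append, length_pad_level hp hx]
  ring

/-! #### The inverter is PPT: the run function as a brick pipeline on `⟨inp, r⟩` -/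

variable (p A qA)

/-- `1ⁿ`. [folklore] -/
noncomputable def uF : List Bool → List Bool := onesFn ∘ fstF ∘ fstF
/-- `1^{K n}`. [folklore] -/
noncomputable def kF : List Bool → List Bool := polyFn (Kpoly p qA) ∘ uF
/-- `⟨1^{|r| / K n}, 1^{|r| mod K n}⟩`. [folklore] -/
noncomputable def dmF : List Bool → List Bool := divModFn ∘ fanoutFn (kF p qA) (onesFn ∘ sndF)
/-- `z = r ↾ j`. [folklore] -/
noncomputable def zF : List Bool → List Bool := takeFn ∘ fanoutFn (fstF ∘ dmF p qA) sndF
/-- `A`'s coins `(r ⇂ j) ↾ κ`. [folklore] -/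
noncomputable def rAF : List Bool → List Bool :=
  takeFn ∘ fanoutFn (sndF ∘ dmF p qA) (dropFn ∘ fanoutFn (fstF ∘ dmF p qA) sndF)
/-- `1^{M n - 1}`. [folklore] -/
noncomputable def LvF : List Bool → List Bool := polyFn (p + X) ∘ uF
/-- The query `⟨1^{M n + |z|}, pad (M n - 1) y ++ z⟩`. [folklore] -/
noncomputable def qF : List Bool → List Bool :=
  fanoutFn (concatFn ∘ fanoutFn (List.cons true ∘ LvF p) (onesFn ∘ zF p qA))
    (concatFn ∘ fanoutFn (pad10Fn ∘ fanoutFn (LvF p) (sndF ∘ fstF)) (zF p qA))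
/-- `A` as a string function `⟨q, r_A⟩ ↦ A(q; r_A)`. [folklore] -/
def bFn : List Bool → List Bool := Function.uncurry A.run ∘ boolUnpair
/-- `A`'s answer. [folklore] -/
noncomputable def ansF : List Bool → List Bool := bFn A ∘ fanoutFn (qF p qA) (rAF p qA)
/-- **The whole run function on `⟨inp, r⟩`**: the first `n` bits of the answer. [folklore] -/
noncomputable def runF : List Bool → List Bool := takeFn ∘ fanoutFn (uF) (ansF p A qA)

variable {p A qA}

/-- `onesFn w = 1^{|w|}`. [folklore] -/
private theorem onesFn_eq_ones (w : List Bool) : onesFn w = ones w.length := by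
  simp [onesFn, Complexity.unaryEncodeNat_eq_replicate, ones]

/-- **The pipeline computes the run function** (on every pair: both sides only read `boolUnpair inp`). [folklore] -/
theorem runF_boolPair (inp r : List Bool) : runF p A qA (boolPair inp r) = advRun p A qA inp r := by
  set n := (boolUnpair inp).1.length with hn
  set j := r.length / K p qA n with hj
  set κ := r.length % K p qA n with hκ
  have hM : M p n - 1 + 1 = M p n := by unfold M; omega
  have hu : uF (boolPair inp r) = ones n := by
    rw [uF, Function.comp_apply, Function.comp_apply, fstF_boolPair, onesFn_eq_ones]; rfl
  have hk : kF p qA (boolPair inp r) = ones (K p qA n) := by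
    rw [kF, Function.comp_apply, hu, polyFn_apply, List.length_replicate]; rfl
  have hdm : dmF p qA (boolPair inp r) = boolPair (ones j) (ones κ) := by
    rw [dmF, Function.comp_apply, fanoutFn_apply, hk, Function.comp_apply, sndF_boolPair, onesFn_eq_ones,
      divModFn_boolPair]
  have hz : zF p qA (boolPair inp r) = r.take j := by
    rw [zF, Function.comp_apply, fanoutFn_apply, Function.comp_apply, hdm, fstF_boolPair, sndF_boolPair, takeFn_boolPair,
      List.length_replicate]
  have hrA : rAF p qA (boolPair inp r) = (r.drop j).take κ := by
    rw [rAF, Function.comp_apply, fanoutFn_apply, Function.comp_apply, hdm, sndF_boolPair, Function.comp_apply,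
      fanoutFn_apply, Function.comp_apply, hdm, fstF_boolPair, sndF_boolPair, dropFn_boolPair, takeFn_boolPair,
      List.length_replicate, List.length_replicate]
  have hL : LvF p (boolPair inp r) = ones (M p n - 1) := by
    rw [LvF, Function.comp_apply, hu, polyFn_apply, List.length_replicate, eval_add, eval_X]
    congr 1
  have hq1 : (concatFn ∘ fanoutFn (List.cons true ∘ LvF p) (onesFn ∘ zF p qA)) (boolPair inp r) =
      unaryEncodeNat (M p n + (r.take j).length) := by
    rw [Function.comp_apply, fanoutFn_apply, Function.comp_apply, hL, Function.comp_apply, hz, onesFn_eq_ones,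
      concatFn_boolPair, Complexity.unaryEncodeNat_eq_replicate]
    show (true :: List.replicate (M p n - 1) true) ++ List.replicate (r.take j).length true = _
    rw [← List.replicate_succ, List.replicate_append_replicate, hM]
  have hq2 : (concatFn ∘ fanoutFn (pad10Fn ∘ fanoutFn (LvF p) (sndF ∘ fstF)) (zF p qA)) (boolPair inp r) =
      pad (M p n - 1) (boolUnpair inp).2 ++ r.take j := by
    rw [Function.comp_apply, fanoutFn_apply, Function.comp_apply, fanoutFn_apply, hL, Function.comp_apply,
      fstF_boolPair, hz, pad10Fn_boolPair, concatFn_boolPair]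
    rfl
  have hq : qF p qA (boolPair inp r) = query p n (boolUnpair inp).2 (r.take j) := by
    rw [qF, fanoutFn_apply, hq1, hq2]
    rfl
  have hans : ansF p A qA (boolPair inp r) = A.run (query p n (boolUnpair inp).2 (r.take j)) ((r.drop j).take κ) := by
    rw [ansF, Function.comp_apply, fanoutFn_apply, hq, hrA, bFn, Function.comp_apply, boolUnpair_boolPair]
    rfl
  rw [runF, Function.comp_apply, fanoutFn_apply, hu, hans, takeFn_boolPair, List.length_replicate]
  rfl

/-- `runF ∈ FP` for a PPT `A`. [Arora–Barak 2009, §1.3 (composition)] [folklore] -/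
theorem runF_mem_FP (hA : IsPPT A id) : runF p A qA ∈ FP := by
  have hu : uF ∈ FP := comp_mem_FP onesFn_mem_FP (comp_mem_FP fstF_mem_FP fstF_mem_FP)
  have hk : kF p qA ∈ FP := comp_mem_FP (polyFn_mem_FP _) hu
  have hdm : dmF p qA ∈ FP := comp_mem_FP divModFn_mem_FP (fanoutFn_mem_FP hk (comp_mem_FP onesFn_mem_FP sndF_mem_FP))
  have hz : zF p qA ∈ FP := comp_mem_FP takeFn_mem_FP (fanoutFn_mem_FP (comp_mem_FP fstF_mem_FP hdm) sndF_mem_FP)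
  have hrA : rAF p qA ∈ FP := comp_mem_FP takeFn_mem_FP (fanoutFn_mem_FP (comp_mem_FP sndF_mem_FP hdm)
    (comp_mem_FP dropFn_mem_FP (fanoutFn_mem_FP (comp_mem_FP fstF_mem_FP hdm) sndF_mem_FP)))
  have hL : LvF p ∈ FP := comp_mem_FP (polyFn_mem_FP _) hu
  have hq : qF p qA ∈ FP :=
    fanoutFn_mem_FP (comp_mem_FP concatFn_mem_FP (fanoutFn_mem_FP (comp_mem_FP (cons_mem_FP true) hL)
        (comp_mem_FP onesFn_mem_FP hz)))
      (comp_mem_FP concatFn_mem_FP (fanoutFn_mem_FP (comp_mem_FP pad10Fn_mem_FP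
        (fanoutFn_mem_FP hL (comp_mem_FP sndF_mem_FP fstF_mem_FP))) hz))
  have hb : bFn A ∈ FP := by
    show PolyTimeComputable id id (Function.uncurry A.run ∘ boolUnpair)
    exact PolyTimeComputable.comp_holds hA.1 polyTimeComputable_boolUnpair
  have hans : ansF p A qA ∈ FP := comp_mem_FP hb (fanoutFn_mem_FP hq hrA)
  exact comp_mem_FP takeFn_mem_FP (fanoutFn_mem_FP hu hans)

/-- The run function of `A'` is polynomial-time on the pair presentation of (input, coins) (the time
core of `IsPPT`). [Goldreich 2001, §1.3.2; Arora–Barak 2009, §7.1] [folklore] -/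
theorem advRun_polyTime (hA : IsPPT A id) :
    PolyTimeComputable (fun q : List Bool × List Bool => boolPair (id q.1) q.2) id
      (Function.uncurry (advRun p A qA)) := by
  obtain ⟨pc, Mc, hM⟩ := runF_mem_FP (p := p) (A := A) (qA := qA) hA
  refine ⟨pc, Mc, fun q => ?_⟩
  have h := hM (boolPair q.1 q.2)
  rw [id, runF_boolPair] at h
  exact h

/-- **`A'` is PPT** for a PPT `A` and a polynomially bounded coin budget. [Goldreich 2001, §1.3.2] [folklore] -/
theorem adv_isPPT (hA : IsPPT A id) {cl : ℕ → ℕ} (hcl : ∃ pc : Polynomial ℕ, ∀ ℓ, cl ℓ ≤ pc.eval ℓ) :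
    IsPPT (adv p A qA cl) id :=
  ⟨advRun_polyTime hA, hcl⟩

end Adversary

/-! ### The advice: the length to attack and `A`'s coin count, carried by the coin budget -/

/-- The data of the reduction: the length bound `p` of `f`, the `g`-inverter `A` with a polynomial
bound `qA` on its coin budget, and the exponent `k` of its success bound `1/m^k`. [folklore] -/
structure Setting where
  /-- the output-length bound of `f` [folklore] -/
  p : Polynomial ℕ
  /-- the function [folklore] -/
  f : List Bool → List Bool
  /-- the inverter for `g` [folklore] -/
  A : RandAlg (List Bool) (List Bool)
  /-- a polynomial bound on `A`'s coin budget [folklore] -/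
  qA : Polynomial ℕ
  /-- the exponent of `A`'s success bound [folklore] -/
  k : ℕ

namespace Setting

open scoped Classical

variable (S : Setting)

/-- Level `n` is good: `A` inverts `g` on some `U_m` of level `n` with probability `≥ 1/m^k`. [folklore] -/
def GoodLen (n : ℕ) : Prop :=
  ∃ j, M S.p n + j < M S.p (n + 1) ∧ 1 / ((M S.p n + j : ℕ) : ℝ) ^ S.k ≤ invertProb (g S.p S.f) S.A (M S.p n + j)

/-- The advice `j(n)`: the offset of a good length of level `n` (else `0`). [folklore] -/
noncomputable def jA (n : ℕ) : ℕ := if h : S.GoodLen n then Classical.choose h else 0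

/-- The advice `κ(n)`: `A`'s coin count on the queries of level `n`. [folklore] -/
noncomputable def κA (n : ℕ) : ℕ := S.A.coinLen (3 * (M S.p n + S.jA n) + 2)

/-- **The coin count encoding the advice**: `Code n = j(n) · K n + κ(n)`. [folklore] -/
noncomputable def Code (n : ℕ) : ℕ := S.jA n * K S.p S.qA n + S.κA n

/-- A polynomial bound on `Code`. [folklore] -/
noncomputable def CodePoly : Polynomial ℕ := M1poly S.p * Kpoly S.p S.qA + Kpoly S.p S.qA

/-- The spread of input lengths `|⟨1ⁿ, f x⟩|`, `|x| = n`: `2n + 2 + p(n)`. [folklore] -/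
def spread (n : ℕ) : ℕ := 2 * n + 2 + S.p.eval n

/-- **The coin budget of `A'`**: on an input length `ℓ` in the range of a selected level `n`
(`Yao.sel`, the sparse selection of `YaoAmplification.lean`), `Code n` coins. [folklore] -/
noncomputable def cl (G : ℕ → Prop) (ℓ : ℕ) : ℕ :=
  if 2 * Yao.sel G S.spread ℓ + 2 ≤ ℓ then S.Code (Yao.sel G S.spread ℓ) else 0

/-- The inverter of the setting with the advice-carrying budget. [folklore] -/
noncomputable def inv (G : ℕ → Prop) : RandAlg (List Bool) (List Bool) := adv S.p S.A S.qA (S.cl G)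

variable {S}

/-- The advised length has level `n`. [folklore] -/
theorem jA_lt (n : ℕ) : M S.p n + S.jA n < M S.p (n + 1) := by
  unfold jA
  split_ifs with h
  · exact (Classical.choose_spec h).1
  · simpa using M_strictMono (p := S.p) (Nat.lt_succ_self n)

/-- At a good level the advised length is one where `A` does well. [folklore] -/
theorem jA_spec {n : ℕ} (h : S.GoodLen n) :
    1 / ((M S.p n + S.jA n : ℕ) : ℝ) ^ S.k ≤ invertProb (g S.p S.f) S.A (M S.p n + S.jA n) := by
  unfold jA; rw [dif_pos h]; exact (Classical.choose_spec h).2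

/-- `κ(n) < K n` when `qA` bounds `A`'s coin budget. [folklore] -/
theorem κA_lt (hqA : ∀ ℓ, S.A.coinLen ℓ ≤ S.qA.eval ℓ) (n : ℕ) : S.κA n < K S.p S.qA n := by
  rw [K_eq, κA, Nat.lt_succ_iff]
  refine (hqA _).trans (TM2Iter.eval_mono _ ?_)
  have := jA_lt (S := S) n
  omega

/-- Decoding the advice: `Code n / K n = j(n)`. [folklore] -/
theorem Code_div (hqA : ∀ ℓ, S.A.coinLen ℓ ≤ S.qA.eval ℓ) (n : ℕ) : S.Code n / K S.p S.qA n = S.jA n := by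
  have hK := κA_lt hqA n
  rw [Code, Nat.add_comm, Nat.add_mul_div_right _ _ (by omega), Nat.div_eq_of_lt hK, Nat.zero_add]

/-- Decoding the advice: `Code n mod K n = κ(n)`. [folklore] -/
theorem Code_mod (hqA : ∀ ℓ, S.A.coinLen ℓ ≤ S.qA.eval ℓ) (n : ℕ) : S.Code n % K S.p S.qA n = S.κA n := by
  have hK := κA_lt hqA n
  rw [Code, Nat.add_comm, Nat.add_mul_mod_self_right, Nat.mod_eq_of_lt hK]

/-- `j(n) + κ(n) ≤ Code n`. [folklore] -/
theorem jA_add_κA_le (hqA : ∀ ℓ, S.A.coinLen ℓ ≤ S.qA.eval ℓ) (n : ℕ) : S.jA n + S.κA n ≤ S.Code n := by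
  have hK : 1 ≤ K S.p S.qA n := by have := κA_lt hqA n; omega
  unfold Code
  nlinarith

/-- `Code n ≤ CodePoly(n)`. [folklore] -/
theorem Code_le (hqA : ∀ ℓ, S.A.coinLen ℓ ≤ S.qA.eval ℓ) (n : ℕ) : S.Code n ≤ S.CodePoly.eval n := by
  have h1 : S.jA n ≤ M S.p (n + 1) := by have := jA_lt (S := S) n; omega
  have h2 := (κA_lt hqA n).le
  simp only [Code, CodePoly, eval_add, eval_mul, eval_M1poly]
  unfold K at h2 ⊢
  exact Nat.add_le_add (Nat.mul_le_mul_right _ h1) h2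

/-- `n ≤ spread n`. [folklore] -/
theorem spread_ge (n : ℕ) : n ≤ S.spread n := by unfold spread; omega

/-- The coin budget is polynomially bounded. [folklore] -/
theorem cl_le (hqA : ∀ ℓ, S.A.coinLen ℓ ≤ S.qA.eval ℓ) (G : ℕ → Prop) (ℓ : ℕ) : S.cl G ℓ ≤ S.CodePoly.eval ℓ := by
  unfold cl
  split_ifs with h
  · exact (Code_le hqA _).trans (TM2Iter.eval_mono _ (by omega))
  · exact Nat.zero_le _

/-- **On the inputs `⟨1ⁿ, f x⟩`, `|x| = n`, of a selected level `n` the budget is `Code n`.** [folklore] -/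
theorem cl_eq {G : ℕ → Prop} (hG : ∀ a, ∃ b, a ≤ b ∧ G b) (hp : LenBound S.p S.f) (i : ℕ) {x : List Bool}
    (hx : x.length = Yao.seqN G S.spread i) :
    S.cl G (boolPair (unaryEncodeNat (Yao.seqN G S.spread i)) (S.f x)).length = S.Code (Yao.seqN G S.spread i) := by
  have hℓ : (boolPair (unaryEncodeNat (Yao.seqN G S.spread i)) (S.f x)).length =
      2 * Yao.seqN G S.spread i + 2 + (S.f x).length := by
    rw [length_boolPair, length_unaryEncodeNat]
  have hfx : (S.f x).length ≤ S.p.eval (Yao.seqN G S.spread i) := by rw [← hx]; exact hp x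
  have hsel : Yao.sel G S.spread (boolPair (unaryEncodeNat (Yao.seqN G S.spread i)) (S.f x)).length = Yao.seqN G S.spread i :=
    Yao.sel_eq hG spread_ge (by rw [hℓ]; omega) (by rw [hℓ, spread]; omega)
  unfold cl
  rw [hsel, if_pos (by rw [hℓ]; omega)]

/-- The inverter is PPT (for a PPT `A` whose coin budget `qA` bounds). [folklore] -/
theorem isPPT_inv (hA : IsPPT S.A id) (hqA : ∀ ℓ, S.A.coinLen ℓ ≤ S.qA.eval ℓ) (G : ℕ → Prop) : IsPPT (S.inv G) id :=
  adv_isPPT hA ⟨S.CodePoly, cl_le hqA G⟩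

end Setting

/-! ### Counting: a success of `A` is a success of `A'` -/

section Counting

/-- A `RandAlg` probability as the uniform average of the indicator over the coin strings.
[Arora–Barak 2009, §7.1] [folklore] -/
theorem pr_eq_uniformAvg_ite {α β : Type} (B : RandAlg α β) (ea : α → List Bool) (a : α) (E : Set β)
    [DecidablePred (· ∈ E)] {k : ℕ} (hk : B.coinLen (ea a).length = k) :
    B.pr ea a E = uniformAvg k (fun r => if B.run a r ∈ E then 1 else 0) := by
  classical
  rw [B.pr_eq_card_filter_div ea a E hk, uniformAvg]
  congr 1
  rw [Finset.natCast_card_filter]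

/-- Monotonicity of uniform averages, pointwise on strings of the given length (twin of
`uniformAvg_mono` of `LiuPassLemma53Hiding.lean`, not imported here). [folklore] -/
private theorem uniformAvg_mono' {m : ℕ} {F G : List Bool → ℝ} (h : ∀ x : List Bool, x.length = m → F x ≤ G x) :
    uniformAvg m F ≤ uniformAvg m G := by
  unfold uniformAvg
  exact div_le_div_of_nonneg_right (Finset.sum_le_sum fun x _ => h _ (by simp)) (by positivity)

/-- A function of a suffix of the coins: the leading coins average out. [folklore] -/
private theorem uniformAvg_drop (a b : ℕ) (F : List Bool → ℝ) :
    uniformAvg (a + b) (fun r => F (r.drop a)) = uniformAvg b F := by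
  have h := uniformAvg_add a b (fun _ w => F w)
  simp only [uniformAvg_const] at h
  exact h

/-- Comparison of indicators. [folklore] -/
private theorem ite_le_ite_of_imp {P Q : Prop} [Decidable P] [Decidable Q] (h : P → Q) :
    (if P then (1 : ℝ) else 0) ≤ if Q then 1 else 0 := by
  by_cases hP : P
  · rw [if_pos hP, if_pos (h hP)]
  · rw [if_neg hP]; split_ifs <;> norm_num

variable {S : Setting}

/-- **The pointwise comparison.** For `|x| = n` at a level where the budget is `Code n`: averaged over
the suffix `z ← U_{j(n)}`, the probability that `A` inverts `g` on `pad (M n - 1) (f x) ++ z` is at most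
the probability that `A'` inverts `f` on `f x` (the coins of `A'` enumerate (`z`, coins of `A`, unused
coins), and successes map to successes, `f_take_eq_of_g_eq`). [Goldreich 2001, Prop. 2.2.5 (proof sketch)]
[folklore] -/
theorem key_le (hp : LenBound S.p S.f) (hqA : ∀ ℓ, S.A.coinLen ℓ ≤ S.qA.eval ℓ) {n : ℕ} {x : List Bool}
    (hx : x.length = n) {cl : ℕ → ℕ} (hcl : cl (boolPair (unaryEncodeNat n) (S.f x)).length = S.Code n) :
    uniformAvg (S.jA n) (fun z => S.A.pr id (query S.p n (S.f x) z)
        {w' | g S.p S.f w' = pad (M S.p n - 1) (S.f x) ++ z}) ≤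
      (adv S.p S.A S.qA cl).pr id (boolPair (unaryEncodeNat n) (S.f x)) {w | S.f w = S.f x} := by
  set j := S.jA n with hj
  set κ := S.κA n with hκ
  obtain ⟨e, he⟩ : ∃ e, S.Code n = j + (κ + e) := by
    obtain ⟨e, he⟩ := Nat.exists_eq_add_of_le (Setting.jA_add_κA_le hqA n)
    exact ⟨e, by rw [he]; ring⟩
  -- the success indicator of `A'` as a function of (`z`, coins of `A`)
  set F : List Bool → List Bool → ℝ := fun z rA =>
    if S.f ((S.A.run (query S.p n (S.f x) z) rA).take n) = S.f x then 1 else 0 with hF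
  -- the right-hand side over the coins `z r_A r_unused`
  have hc : (adv S.p S.A S.qA cl).coinLen (id (boolPair (unaryEncodeNat n) (S.f x))).length = j + (κ + e) := by
    rw [← he]; exact hcl
  have hrun : ∀ r : List Bool, r.length = j + (κ + e) →
      (adv S.p S.A S.qA cl).run (boolPair (unaryEncodeNat n) (S.f x)) r =
        (S.A.run (query S.p n (S.f x) (r.take j)) ((r.drop j).take κ)).take n := by
    intro r hr
    show advRun S.p S.A S.qA (boolPair (unaryEncodeNat n) (S.f x)) r = _
    rw [advRun_boolPair, advCore, hr, ← he, Setting.Code_div hqA, Setting.Code_mod hqA]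
  have hR : (adv S.p S.A S.qA cl).pr id (boolPair (unaryEncodeNat n) (S.f x)) {w | S.f w = S.f x} =
      uniformAvg j (fun z => uniformAvg κ (F z)) := by
    rw [pr_eq_uniformAvg_ite _ id _ _ hc,
      uniformAvg_congr (m := j + (κ + e)) (g := fun r => F (r.take j) ((r.drop j).take κ))
        (fun r hr => by simp only [Set.mem_setOf_eq, hrun r hr, hF]),
      uniformAvg_add j (κ + e) (fun z r' => F z (r'.take κ))]
    congr 1
    funext z
    exact uniformAvg_take κ e (F z)
  rw [hR]
  refine uniformAvg_mono' fun z hz => ?_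
  -- the left-hand side over `A`'s coins
  have hkA : S.A.coinLen (id (query S.p n (S.f x) z)).length = κ := by
    rw [id, length_query hp hx, hz]
    rfl
  rw [pr_eq_uniformAvg_ite _ id _ _ hkA]
  refine uniformAvg_mono' fun rA _ => ite_le_ite_of_imp fun hsucc => ?_
  exact f_take_eq_of_g_eq hp (Setting.jA_lt n) hx hz hsucc

/-- **Success probabilities compare**: `Pr[A inverts g on U_{M n + j(n)}] ≤ Pr[A' inverts f on U_n]`
at every level `n` where the budget is `Code n`. [Goldreich 2001, Prop. 2.2.5 with Prop. 2.2.3]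
[cite: Goldreich2001, Prop. 2.2.5 (proof sketch)] -/
theorem invertProb_g_le (hp : LenBound S.p S.f) (hqA : ∀ ℓ, S.A.coinLen ℓ ≤ S.qA.eval ℓ) {n : ℕ} {cl : ℕ → ℕ}
    (hcl : ∀ x : List Bool, x.length = n → cl (boolPair (unaryEncodeNat n) (S.f x)).length = S.Code n) :
    invertProb (g S.p S.f) S.A (M S.p n + S.jA n) ≤ invertProb S.f (adv S.p S.A S.qA cl) n := by
  set j := S.jA n with hj
  have hlt := lt_M (p := S.p) n
  have hjl := Setting.jA_lt (S := S) n
  have hm : M S.p n + j = n + (M S.p n - n + j) := by omega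
  -- the sample `w = x u z`
  have hsplit : ∀ w : List Bool, w.length = n + (M S.p n - n + j) →
      S.A.pr id (boolPair (unaryEncodeNat (n + (M S.p n - n + j))) (g S.p S.f w)) {w' | g S.p S.f w' = g S.p S.f w} =
        (fun x rest => S.A.pr id (query S.p n (S.f x) (rest.drop (M S.p n - n)))
          {w' | g S.p S.f w' = pad (M S.p n - 1) (S.f x) ++ rest.drop (M S.p n - n)}) (w.take n) (w.drop n) := by
    intro w hw
    have hg : g S.p S.f w = pad (M S.p n - 1) (S.f (w.take n)) ++ (w.drop n).drop (M S.p n - n) := by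
      rw [g_eq_of_level (n := n) (by omega) (by omega), List.drop_drop]
      congr 2
      omega
    have hlen : ((w.drop n).drop (M S.p n - n)).length = j := by
      simp only [List.length_drop, hw]; omega
    simp only [hg, query, hlen, hm]
  unfold invertProb
  rw [hm, uniformAvg_congr hsplit, uniformAvg_add n (M S.p n - n + j) (fun x rest =>
    S.A.pr id (query S.p n (S.f x) (rest.drop (M S.p n - n)))
      {w' | g S.p S.f w' = pad (M S.p n - 1) (S.f x) ++ rest.drop (M S.p n - n)})]
  refine uniformAvg_mono' fun x hx => ?_
  rw [uniformAvg_drop (M S.p n - n) j (fun z => S.A.pr id (query S.p n (S.f x) z)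
    {w' | g S.p S.f w' = pad (M S.p n - 1) (S.f x) ++ z})]
  exact key_le hp hqA hx (hcl x hx)

end Counting

/-! ### The main theorem -/

section Main

/-- A nonnegative sequence that is not negligible is at least `1/n^k` infinitely often (the
contrapositive reading of `isNegligible_iff_eventually_lt_of_nonneg`). [Goldreich 2001, §1.3.5] [folklore] -/
private theorem exists_frequently_ge_of_not_superpolynomialDecay {u : ℕ → ℝ} (h0 : ∀ n, 0 ≤ u n)
    (h : ¬ SuperpolynomialDecay atTop (fun n : ℕ => (n : ℝ)) u) :
    ∃ k : ℕ, ∃ᶠ n : ℕ in atTop, 1 / (n : ℝ) ^ k ≤ u n := by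
  have h' := (isNegligible_iff_eventually_lt_of_nonneg h0).not.1 h
  push Not at h'
  obtain ⟨c, hc⟩ := h'
  exact ⟨c, by simpa [Filter.not_eventually, not_lt] using hc⟩

/-- **`g` is one-way** for a one-way `f` with output-length bound `p`: a PPT `A` inverting `g` on
`U_m` with probability `≥ 1/m^k` for infinitely many `m` does so at infinitely many levels
`n = nOf m`; along a sparse sequence of such levels (disjoint input-length ranges, `Yao.seqN`) the
inverter `A'` with the advice-carrying coin budget inverts `f` on `U_n` with probability
`≥ 1/M(n+1)^k` (`invertProb_g_le`), contradicting the negligibility of its success.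
[Goldreich 2001, Prop. 2.2.5 with Prop. 2.2.3] [cite: Goldreich2001, Prop. 2.2.5 with Prop. 2.2.3] -/
theorem isOneWay_g (hf : IsOneWay f) (hp : LenBound p f) : IsOneWay (g p f) := by
  refine ⟨g_mem_FP hf.1, fun A hA => ?_⟩
  by_contra hns
  obtain ⟨k, hfreq⟩ := exists_frequently_ge_of_not_superpolynomialDecay (fun m => invertProb_nonneg _ A m) hns
  obtain ⟨qA, hqA⟩ := hA.2
  let S : Setting := ⟨p, f, A, qA, k⟩
  -- good levels are frequent
  have hgood : ∃ᶠ n in atTop, S.GoodLen n := by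
    have h1 : ∃ᶠ m in atTop, S.GoodLen (nOf p m) := by
      refine (hfreq.and_eventually (eventually_ge_atTop (M p 0))).mono fun m hm => ?_
      obtain ⟨hm, hm0⟩ := hm
      refine ⟨m - M p (nOf p m), ?_, ?_⟩
      · rw [Nat.add_sub_cancel' (M_nOf_le hm0)]; exact lt_M_nOf_succ m
      · rw [Nat.add_sub_cancel' (M_nOf_le hm0)]; exact hm
    exact tendsto_nOf.frequently h1
  have hG' : ∀ a, ∃ b, a ≤ b ∧ S.GoodLen b := fun a => by
    obtain ⟨b, hb, hGb⟩ := frequently_atTop.1 hgood a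
    exact ⟨b, hb, hGb⟩
  -- the inverter with the advice-carrying coin budget, and the negligibility of its success
  have hPPT : IsPPT (S.inv S.GoodLen) id := Setting.isPPT_inv hA hqA _
  have hdec := hf.2 _ hPPT
  -- along the selected levels the inverter does well
  have hlow : ∀ i, 1 / ((M p (Yao.seqN S.GoodLen S.spread i + 1) : ℕ) : ℝ) ^ k ≤
      invertProb f (S.inv S.GoodLen) (Yao.seqN S.GoodLen S.spread i) := by
    intro i
    have hgoodn : S.GoodLen (Yao.seqN S.GoodLen S.spread i) := Yao.seqN_good hG' i
    have hjl := Setting.jA_lt (S := S) (Yao.seqN S.GoodLen S.spread i)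
    calc 1 / ((M p (Yao.seqN S.GoodLen S.spread i + 1) : ℕ) : ℝ) ^ k
        ≤ 1 / ((M p (Yao.seqN S.GoodLen S.spread i) + S.jA (Yao.seqN S.GoodLen S.spread i) : ℕ) : ℝ) ^ k := by
          refine one_div_le_one_div_of_le (pow_pos ?_ _) (pow_le_pow_left₀ (by positivity) (by exact_mod_cast hjl.le) _)
          have := lt_M (p := p) (Yao.seqN S.GoodLen S.spread i)
          exact_mod_cast (show 0 < M p (Yao.seqN S.GoodLen S.spread i) + S.jA (Yao.seqN S.GoodLen S.spread i) by omega)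
      _ ≤ invertProb (g p f) A (M p (Yao.seqN S.GoodLen S.spread i) + S.jA (Yao.seqN S.GoodLen S.spread i)) :=
          Setting.jA_spec hgoodn
      _ ≤ invertProb f (S.inv S.GoodLen) (Yao.seqN S.GoodLen S.spread i) :=
          invertProb_g_le (S := S) hp hqA fun x hx => Setting.cl_eq hG' hp i hx
  -- but `M(n+1)^k · Pr[A' inverts f on U_n] → 0`
  have ht : Tendsto (fun n => ((M p (n + 1) : ℕ) : ℝ) ^ k * invertProb f (S.inv S.GoodLen) n) atTop (nhds 0) := by
    have h := hdec.polynomial_mul ((M1poly p).map (Nat.castRingHom ℝ) ^ k) 0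
    refine h.congr' (Eventually.of_forall fun n => ?_)
    simp only [pow_zero, one_mul, eval_pow, eval_natCast_map, eval_M1poly, eq_natCast, Nat.cast_id]
  obtain ⟨N, hN⟩ := eventually_atTop.1 ((tendsto_order.1 ht).2 1 one_pos)
  have hmono := Yao.seqN_strictMono hG' (Setting.spread_ge (S := S))
  have hNn : N ≤ Yao.seqN S.GoodLen S.spread N := hmono.id_le N
  have h1 := hN _ hNn
  have h2 := hlow N
  have hMpos : (0 : ℝ) < ((M p (Yao.seqN S.GoodLen S.spread N + 1) : ℕ) : ℝ) ^ k := by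
    have := lt_M (p := p) (Yao.seqN S.GoodLen S.spread N + 1)
    exact pow_pos (by exact_mod_cast (show 0 < M p (Yao.seqN S.GoodLen S.spread N + 1) by omega)) _
  rw [div_le_iff₀ hMpos] at h2
  have hcomm := mul_comm (((M p (Yao.seqN S.GoodLen S.spread N + 1) : ℕ) : ℝ) ^ k)
    (invertProb f (S.inv S.GoodLen) (Yao.seqN S.GoodLen S.spread N))
  linarith

end Main

end LenPres

/-! ### One-way functions may be assumed length-preserving -/

/-- The output length of a polynomial-time function is polynomially bounded
(`exists_poly_length_le_of_mem_FP`, `CountingHierarchyProofs.lean`). [Arora–Barak 2009, §1.3] [folklore] -/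
theorem LenPres.exists_lenBound {f : List Bool → List Bool} (hf : f ∈ FP) : ∃ p, LenPres.LenBound p f :=
  exists_poly_length_le_of_mem_FP hf

/-- **One-way functions may be assumed length-preserving** (Goldreich 2001, §2.2.3.2, Prop. 2.2.5 with
Prop. 2.2.3: "Given a strongly one-way function `f`, we can construct a strongly one-way function `f''`
that is length-preserving" — `f'(x) = f(x)10^{p(|x|)-|f(x)|}` (eq. (2.3)), `f''(x'x'') = f'(x')`
(eq. (2.4)), extended from the lengths `p(n)+1` to all lengths by `g'(x) = f''(x')x''` (eq. (2.2))):
if `f` is one-way then `LenPres.g p f` — for a length bound `p` of `f` — is one-way and length-preserving.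
[cite: Goldreich2001, Prop. 2.2.5 with Prop. 2.2.3] -/
theorem IsOneWay.exists_isLengthPreserving {f : List Bool → List Bool} (hf : IsOneWay f) :
    ∃ g : List Bool → List Bool, IsOneWay g ∧ IsLengthPreserving g := by
  obtain ⟨p, hp⟩ := LenPres.exists_lenBound hf.1
  exact ⟨LenPres.g p f, LenPres.isOneWay_g hf hp, LenPres.isLengthPreserving_g hp⟩

/-- **If one-way functions exist, then length-preserving one-way functions exist.**
[Goldreich 2001, §2.2.3.2, Prop. 2.2.5 with Prop. 2.2.3] [cite: Goldreich2001, Prop. 2.2.5 with Prop. 2.2.3] -/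
theorem OWFExist.exists_isLengthPreserving (h : OWFExist) :
    ∃ g : List Bool → List Bool, IsOneWay g ∧ IsLengthPreserving g := by
  obtain ⟨f, hf⟩ := h
  exact hf.exists_isLengthPreserving

end Literature.Computability.Cryptography
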